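import Summits.ValiantsHypothesis.ValiantsHypothesis.Theorems.ZeroOneTransfer.Negative.KillRows
import Mathlib

/-!
# Padding lemma for line `arborescence-span` (crux `ZeroOneTransfer`, stmt-ValiantsHypothesis-5066) —
# definitions, and entries of iterated matrix products as path sums

Support file (the definitions, their membership / unfolding lemmas, and the registered sub-goal
`stub_immToSpan_pathSum`) for `stub_immToSpan` (statement `IMMToSpan` of the lead's skeleton of line
`arborescence-span`; further proofs in `Theorems/DivisionGapZeroOneTransferIMMToSpan{Aux,Graph}.lean`,
main file `Theorems/DivisionGapZeroOneTransferIMMToSpan.lean`).  The stub: for labelled matrices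
`M : Fin d → Matrix ι ι R` (every entry a variable or a constant) the entries of `M_0 ⋯ M_{d-1}`, times
ONE common nonzero factor, are positive projections of Jerrum–Snir's spanning-tree polynomial
`stPoly R N`, `N ≤ 4 (#ι + d + 1)^8`.

* `arbsV V`, `wt`, `stV lab` — arborescences (parent maps `T : V → Option V`, root `none`, with a
  rank strictly decreasing along parent pointers; on `Fin N` this is `IsArborescence` by
  `isArborescence_iff_exists_rank`) on a finite vertex type `V`, the weight `Π_v lab v (T v)` of a
  parent map under an arc labelling `lab`, and the spanning-tree polynomial `Σ_{T ∈ arbsV V} wt lab T`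
  of the labelled complete rooted digraph on `V`; `transportArb` carries parent maps along `V ≃ Fin N`.
* `pathProd M π`, `paths d s t`, `list_prod_apply` — weights `Π_l M_l (π l) (π (l+1))` of index paths
  `π : Fin (d+1) → ι`, the paths from `s` to `t`, and `(M_0 ⋯ M_{d-1})_{s t} = Σ_{π : s ⇝ t} pathProd M π`
  (registered as `stub_immToSpan_pathSum` in tree vocabulary).
* The padded layered digraph `H_{s,t}` of `M` on the vertex type `VN ι d`: program nodes
  `PN ι d = Fin (d+1) × ι` and one relay per pair (program node `u`, `o : Option (EN ι d)`),
  `EN ι d = Fin d × ι × ι` the matrix entries.  Labels `labH M s t` (second argument `none` = the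
  root): `u → (u, o)` carries `lab₀ M o` (`1` for `o = none`, `M l i j` for `o = (l, i, j)`), so that every
  program node has total out-label `W M = 1 + Σ_{l,i,j} M l i j`; `(d, t)` has moreover a unit arc to
  the root; the relay `(u, o)` has ONE unit arc, to `relayTgt s (u, o)`: the matrix target `(ℓ+1, j)`
  if `u = (ℓ, i)` and `o = (ℓ, i, j)` (own row), the feedback node `(0, s)` otherwise.  An
  arborescence of nonzero weight must follow matrix arcs from `(0, s)` to `(d, t)`; all other program
  nodes choose freely (`ext`, `next`, `ownArc`, `tgt`, `params` parametrise them; `rkP`, `rkV` are the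
  certifying ranks; `stepι`, `pathOf` read the path off an arborescence).
* The bouquet `labA M i₀` on the same vertex type (program nodes `(ℓ, i)`, `i ≠ i₀`, keep their relay
  arcs, everything else hangs on the root) realises the padding factor `W^{(d+1)(#ι-1)}`; `extA`.

Everything is over an arbitrary commutative semiring. [folklore]
-/

noncomputable section

namespace Summit.ValiantsHypothesis.ValiantsHypothesis.Theorems.DivisionGapZeroOneTransfer

-- the single-problem summit's namespace `Summit.ValiantsHypothesis.ValiantsHypothesis` repeats
set_option linter.dupNamespace false

namespace IMMToSpan

open Literature.Computability.AlgebraicComplexity Literature.Barriers.ValiantsHypothesis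
open MvPolynomial Finset
open Summit.ValiantsHypothesis.ValiantsHypothesis.Theorems.ZeroOneTransfer.Negative
  (isArborescence_iff_exists_rank)

/-! ### Arborescences and spanning-tree polynomials on a finite vertex type -/

section General

variable {V : Type} {R : Type} [CommSemiring R]

open Classical in
/-- The finite set of arborescences on the finite vertex type `V`: parent maps `T : V → Option V`
(`none` = the root) admitting a rank strictly decreasing along parent pointers. [folklore] -/
def arbsV (V : Type) [Fintype V] [DecidableEq V] : Finset (V → Option V) :=
  univ.filter fun T => ∃ rk : V → ℕ, ∀ v w, T v = some w → rk w < rk v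

/-- Membership in `arbsV`. [folklore] -/
theorem mem_arbsV [Fintype V] [DecidableEq V] {T : V → Option V} :
    T ∈ arbsV V ↔ ∃ rk : V → ℕ, ∀ v w, T v = some w → rk w < rk v := by
  unfold arbsV
  simp only [Finset.mem_filter, Finset.mem_univ, true_and]

/-- The weight of a parent map under the arc labelling `lab`: `Π_v lab v (T v)`. [folklore] -/
def wt [Fintype V] (lab : V → Option V → R) (T : V → Option V) : R :=
  ∏ v, lab v (T v)

/-- The spanning-tree polynomial of the labelled complete rooted digraph on `V`:
`Σ_{T arborescence} Π_v lab v (T v)`. [folklore] -/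
def stV [Fintype V] [DecidableEq V] (lab : V → Option V → R) : R :=
  ∑ T ∈ arbsV V, wt lab T

/-- Transport of parent maps along `e : V ≃ Fin N`. [folklore] -/
def transportArb {N : ℕ} (e : V ≃ Fin N) : (V → Option V) ≃ (Fin N → Option (Fin N)) :=
  e.arrowCongr (Equiv.optionCongr e)

/-- Pointwise formula for `transportArb`. [folklore] -/
theorem transportArb_apply {N : ℕ} (e : V ≃ Fin N) (T : V → Option V) (i : Fin N) :
    transportArb e T i = (T (e.symm i)).map e := by
  simp [transportArb, Equiv.arrowCongr_apply, Equiv.optionCongr_apply]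

end General

/-! ### Index paths; entries of iterated matrix products as path sums -/

section Paths

variable {R : Type} [CommSemiring R] {ι : Type} [Fintype ι] [DecidableEq ι]

/-- The weight `Π_l M_l (π l) (π (l+1))` of the index path `π`. [folklore] -/
def pathProd {d : ℕ} (M : Fin d → Matrix ι ι R) (π : Fin (d + 1) → ι) : R :=
  ∏ l : Fin d, M l (π l.castSucc) (π l.succ)

/-- The index paths of length `d` from `s` to `t`. [folklore] -/
def paths (d : ℕ) (s t : ι) : Finset (Fin (d + 1) → ι) :=
  univ.filter fun π => π 0 = s ∧ π (Fin.last d) = t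

/-- Membership in `paths`. [folklore] -/
theorem mem_paths {d : ℕ} {s t : ι} {π : Fin (d + 1) → ι} :
    π ∈ paths d s t ↔ π 0 = s ∧ π (Fin.last d) = t := by
  simp [paths]

omit [Fintype ι] [DecidableEq ι] in
/-- Splitting off the first arc of a path weight. [folklore] -/
theorem pathProd_cons {d : ℕ} (M : Fin (d + 1) → Matrix ι ι R) (i : ι) (π : Fin (d + 1) → ι) :
    pathProd M (Fin.cons i π : Fin (d + 1 + 1) → ι) =
      M 0 i (π 0) * pathProd (fun l => M l.succ) π := by
  unfold pathProd
  rw [Fin.prod_univ_succ]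
  rfl

/-- **Entries of an iterated matrix product as path sums**:
`(M_0 ⋯ M_{d-1})_{s t} = Σ_{π : s ⇝ t} Π_l M_l (π l) (π (l+1))`. [folklore] -/
theorem list_prod_apply : ∀ {d : ℕ} (M : Fin d → Matrix ι ι R) (s t : ι),
    (List.ofFn M).prod s t = ∑ π ∈ paths d s t, pathProd M π
  | 0, M, s, t => by
    rw [List.ofFn_zero, List.prod_nil, Matrix.one_apply, paths, Finset.sum_filter]
    rw [Fintype.sum_eq_single (fun _ => s)]
    · simp [pathProd]
    · intro π hπ
      rw [if_neg]
      rintro ⟨h0, -⟩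
      exact hπ (funext fun i => by rw [Fin.fin_one_eq_zero i, h0])
  | d + 1, M, s, t => by
    -- the right-hand side, split at the first arc
    have hR : ∑ π ∈ paths (d + 1) s t, pathProd M π =
        ∑ π : Fin (d + 1) → ι, if π (Fin.last d) = t then
          M 0 s (π 0) * pathProd (fun l => M l.succ) π else 0 := by
      rw [paths, Finset.sum_filter, ← (Fin.consEquiv fun _ : Fin (d + 1 + 1) => ι).sum_comp,
        Fintype.sum_prod_type, Finset.sum_comm]
      refine Fintype.sum_congr _ _ fun π => ?_
      simp only [Fin.consEquiv_apply, Fin.cons_zero, ← Fin.succ_last, Fin.cons_succ, ite_and,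
        Finset.sum_ite_eq', Finset.mem_univ, if_true]
      split_ifs
      · exact pathProd_cons M s π
      · rfl
    rw [hR, List.ofFn_succ, List.prod_cons, Matrix.mul_apply]
    have ih := list_prod_apply (fun l => M l.succ)
    simp_rw [ih, Finset.mul_sum, paths, Finset.sum_filter]
    rw [Finset.sum_comm]
    refine Fintype.sum_congr _ _ fun π => ?_
    simp only [ite_and, Finset.sum_ite_eq, Finset.mem_univ, if_true]

end Paths

/-! ### The vertex type of the padded digraph -/

section Vertices

variable {ι : Type} {d : ℕ}

/-- Program nodes `(ℓ, i)`: layer `ℓ ≤ d`, state `i`. [folklore] -/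
abbrev PN (ι : Type) (d : ℕ) := Fin (d + 1) × ι

/-- Matrix entries `(l, i, j)` ↔ `M l i j`. [folklore] -/
abbrev EN (ι : Type) (d : ℕ) := Fin d × ι × ι

/-- Vertices of the padded digraph: the program nodes, and one relay node per pair (program node,
entry-or-unit). [folklore] -/
inductive VN (ι : Type) (d : ℕ)
  | prog (u : PN ι d)
  | relay (r : PN ι d × Option (EN ι d))
  deriving DecidableEq, Fintype

/-- `VN` as a sum type. [folklore] -/
def vnEquiv : VN ι d ≃ PN ι d ⊕ (PN ι d × Option (EN ι d)) where
  toFun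
    | .prog u => Sum.inl u
    | .relay r => Sum.inr r
  invFun
    | Sum.inl u => .prog u
    | Sum.inr r => .relay r
  left_inv v := by cases v <;> rfl
  right_inv w := by cases w <;> rfl

/-- The number of vertices: `(d+1)·#ι·(d·#ι² + 2)`. [folklore] -/
theorem card_VN (ι : Type) [Fintype ι] (d : ℕ) :
    Fintype.card (VN ι d) =
      (d + 1) * Fintype.card ι * (d * Fintype.card ι * Fintype.card ι + 2) := by
  rw [Fintype.card_congr vnEquiv]
  simp only [Fintype.card_sum, Fintype.card_prod, Fintype.card_option, Fintype.card_fin]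
  ring

/-- Sums over the vertices. [folklore] -/
theorem sum_VN [Fintype ι] {A : Type} [AddCommMonoid A] (f : VN ι d → A) :
    ∑ v, f v = ∑ u, f (.prog u) + ∑ r, f (.relay r) := by
  rw [← vnEquiv.symm.sum_comp f, Fintype.sum_sum_type]
  rfl

/-- Products over the vertices. [folklore] -/
theorem prod_VN [Fintype ι] {A : Type} [CommMonoid A] (f : VN ι d → A) :
    ∏ v, f v = (∏ u, f (.prog u)) * ∏ r, f (.relay r) := by
  rw [← vnEquiv.symm.prod_comp f, Fintype.prod_sum_type]
  rfl

end Vertices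

/-! ### The padded layered digraph `H_{s,t}` and the bouquet -/

section Graph

variable {ι : Type} {d : ℕ}

/-- The chosen arc of the path node `(ℓ, π ℓ)`, `ℓ < d`: through the own-row relay of the entry
`(ℓ, π ℓ, π (ℓ+1))`. [folklore] -/
def ownArc (π : Fin (d + 1) → ι) (ℓ : Fin d) : Option (VN ι d) :=
  some (.relay ((ℓ.castSucc, π ℓ.castSucc), some (ℓ, π ℓ.castSucc, π ℓ.succ)))

/-- The forced choice of a program node on the path `π` (the root at layer `d`). [folklore] -/
def next (π : Fin (d + 1) → ι) (u : PN ι d) : Option (VN ι d) :=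
  Fin.lastCases (motive := fun _ => Option (VN ι d)) none (fun ℓ => ownArc π ℓ) u.1

/-- The index read off a chosen arc (the default if it is not a matrix arc). [folklore] -/
def stepι (dflt : ι) : Option (VN ι d) → ι
  | some (.relay (_, some e)) => e.2.2
  | _ => dflt

/-- The walk from `(0, s)` along the chosen matrix arcs of the parent map `T`. [folklore] -/
def pathOf (s : ι) (T : VN ι d → Option (VN ι d)) : Fin (d + 1) → ι :=
  Fin.induction (motive := fun _ => ι) s fun ℓ i => stepι i (T (.prog (ℓ.castSucc, i)))

variable [DecidableEq ι]

/-- Target of the unique out-arc of the relay `(u, o)`: the matrix arc `(ℓ, i) → (ℓ+1, j)` when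
`o = (ℓ, i, j)` is an entry of `u = (ℓ, i)`'s own row, the feedback arc to `(0, s)` otherwise.
[folklore] -/
def relayTgt (s : ι) (r : PN ι d × Option (EN ι d)) : PN ι d :=
  match r.2 with
  | none => (0, s)
  | some e => if (e.1 : ℕ) = r.1.1 ∧ e.2.1 = r.1.2 then (e.1.succ, e.2.2) else (0, s)

/-- A relay target is the feedback node `(0, s)` or the matrix target one layer up. [folklore] -/
theorem relayTgt_cases (s : ι) (r : PN ι d × Option (EN ι d)) :
    relayTgt s r = (0, s) ∨ ∃ e, r.2 = some e ∧ (e.1 : ℕ) = r.1.1 ∧ e.2.1 = r.1.2 ∧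
      relayTgt s r = (e.1.succ, e.2.2) := by
  unfold relayTgt
  rcases r with ⟨u, _ | e⟩
  · left; rfl
  · dsimp only
    by_cases h : (e.1 : ℕ) = u.1 ∧ e.2.1 = u.2
    · right; exact ⟨e, rfl, h.1, h.2, by rw [if_pos h]⟩
    · left; rw [if_neg h]

/-- The own-row relay `((ℓ, i), (ℓ, i, j))` feeds the matrix arc to `(ℓ + 1, j)`. [folklore] -/
theorem relayTgt_own (s : ι) (ℓ : Fin d) (i j : ι) :
    relayTgt s (((ℓ.castSucc, i) : PN ι d), some (ℓ, i, j)) = (ℓ.succ, j) := by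
  simp [relayTgt]

/-- The parent map of a choice function: relays take their unique arc. [folklore] -/
def ext (s : ι) (c : PN ι d → Option (VN ι d)) : VN ι d → Option (VN ι d)
  | .prog u => c u
  | .relay r => some (.prog (relayTgt s r))

/-- Rank of program nodes certifying the arborescences of `H_{s,t}`: path nodes count down to the
root in steps of two, free nodes sit above everything reachable from them. [folklore] -/
def rkP (π : Fin (d + 1) → ι) (u : PN ι d) : ℕ :=
  if u.2 = π u.1 then 2 * (d - u.1) else 4 * d + 3 - 2 * u.1

/-- Uniform upper bound for `rkP`. [folklore] -/
theorem rkP_le (π : Fin (d + 1) → ι) (u : PN ι d) : rkP π u ≤ 4 * d + 3 - 2 * u.1 := by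
  unfold rkP
  have := u.1.2
  split_ifs <;> omega

/-- The rank on all vertices: a relay sits just above its target. [folklore] -/
def rkV (π : Fin (d + 1) → ι) (s : ι) : VN ι d → ℕ
  | .prog u => rkP π u
  | .relay r => rkP π (relayTgt s r) + 1

variable {R : Type} [CommSemiring R] (M : Fin d → Matrix ι ι R)

/-- The label of an entry (`none` ↦ the unit label `1`). [folklore] -/
def lab₀ : Option (EN ι d) → R
  | none => 1
  | some e => M e.1 e.2.1 e.2.2

/-- Arc labels of `H_{s,t}` (second argument `none` = the root): a program node `u` has the arcs
`u → (u, o)` of label `lab₀ o` and, if `u = (d, t)`, a unit arc to the root; a relay has one unit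
arc to `relayTgt`; every other arc has label `0`. [folklore] -/
def labH (s t : ι) : VN ι d → Option (VN ι d) → R
  | .prog u, none => if u = (Fin.last d, t) then 1 else 0
  | .prog _, some (.prog _) => 0
  | .prog u, some (.relay r) => if r.1 = u then lab₀ M r.2 else 0
  | .relay _, none => 0
  | .relay r, some w => if w = .prog (relayTgt s r) then 1 else 0

/-- Arc labels of the bouquet: the program nodes `(ℓ, i)`, `i ≠ i₀`, have the arcs to their
relays with labels `lab₀`, the others one unit arc to the root; relays hang on the root. [folklore] -/
def labA (i₀ : ι) : VN ι d → Option (VN ι d) → R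
  | .prog u, none => if u.2 = i₀ then 1 else 0
  | .prog _, some (.prog _) => 0
  | .prog u, some (.relay r) => if r.1 = u ∧ u.2 ≠ i₀ then lab₀ M r.2 else 0
  | .relay _, none => 1
  | .relay _, some _ => 0

/-- The parent map of a bouquet choice function. [folklore] -/
def extA (c : PN ι d → Option (VN ι d)) : VN ι d → Option (VN ι d)
  | .prog u => c u
  | .relay _ => none

variable [Fintype ι]

/-- The common out-weight `W = 1 + Σ_{l,i,j} M l i j`. [folklore] -/
def W : R := ∑ o, lab₀ M o

/-- The allowed choices of a program node: forced on the path, free off it. [folklore] -/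
def tgt (π : Fin (d + 1) → ι) (u : PN ι d) : Finset (Option (VN ι d)) :=
  if u.2 = π u.1 then {next π u} else univ

/-- The parameter set: an `s`–`t` index path and a choice function agreeing with it. [folklore] -/
def params (d : ℕ) (s t : ι) : Finset ((Fin (d + 1) → ι) × (PN ι d → Option (VN ι d))) :=
  univ.filter fun p => p.1 ∈ paths d s t ∧ p.2 ∈ Fintype.piFinset (tgt p.1)

/-- Membership in `params`. [folklore] -/
theorem mem_params {s t : ι} {p : (Fin (d + 1) → ι) × (PN ι d → Option (VN ι d))} :
    p ∈ params d s t ↔ p.1 ∈ paths d s t ∧ p.2 ∈ Fintype.piFinset (tgt p.1) := by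
  simp [params]

end Graph

end IMMToSpan

/-! ### Registered sub-goal -/

/-- **Entries of iterated matrix products are path sums** (registered sub-goal
`stub_immToSpan_pathSum` of `stub_immToSpan`, tree vocabulary):
`(M_0 ⋯ M_{d-1})_{s t} = Σ_{π : Fin (d+1) → ι, π 0 = s, π d = t} Π_l M_l (π l) (π (l+1))`. [folklore] -/
theorem stub_immToSpan_pathSum :
    ∀ (R : Type) [CommSemiring R] (ι : Type) [Fintype ι] [DecidableEq ι] (d : ℕ)
      (M : Fin d → Matrix ι ι R) (s t : ι),
      (List.ofFn M).prod s t =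
        ∑ π ∈ Finset.univ.filter (fun π : Fin (d + 1) → ι => π 0 = s ∧ π (Fin.last d) = t),
          ∏ l : Fin d, M l (π (Fin.castSucc l)) (π (Fin.succ l)) :=
  fun _ _ _ _ _ _ M s t => IMMToSpan.list_prod_apply M s t

end Summit.ValiantsHypothesis.ValiantsHypothesis.Theorems.DivisionGapZeroOneTransfer
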